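import Summits.HodgeConjecture.CorCM.OcticWeilFourfoldHodgeOfMarkman
import Literature.NumberTheory.ComplexMultiplication.OcticCMFieldsWithDegenerateTypes
import Literature.NumberTheory.NumberFields.CMFieldCompositum
import Literature.AlgebraicGeometry.ComplexMultiplication.SimpleIffPrimitiveCMType
import HarnessLib

/-!
# COR-CM — a SIMPLE CM abelian fourfold of Weil type has a `2`-TRANSITIVE quartic part (Dodson 1984, read on `Aut(ℂ)`),
# hence: the Hodge conjecture for `B^n × E^a`, `B` ANY simple CM fourfold with `k ⊂ End⁰(B)` of `k`-signature `(2,2)`,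
# GIVEN ONLY Markman's fourfold theorem

Cell `pub-hodgecm2` (COR-CM), seat b30 gen 19 (2026-08-21); count-neutral own lane OCTIC-WEIL22.  Theorems only, no
definition, no named fact, no `sorry`.  HONEST FRAMING: the Hodge-conjecture statements are CONDITIONAL on the displayed
named fact `HodgeTheory.Markman2025_weilClasses_algebraic_abelianFourfold` (unrefereed); `HC_CM` is not asserted.

THE GALOIS INPUT, BY NAME (the tree's Dodson 1984 §3.3.2 files of the lit-deligne-3 lineage, nothing restated): for an
octic CM field `K ⊇ i(k)`, a CM type `Φ` of weight `2` over `k` is DEGENERATE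
(`not_isNondegenerate_of_ncard_inter_eq_two`); if moreover `Φ` is PRIMITIVE — i.e. its realisation `B` is SIMPLE, Shimura
§8.2 Prop. 26 in the `Aut(ℂ)`-form `isSimple_iff_isPrimitive` — then `3 ∣ |Gal(Kᶜ/ℚ)|`
(`three_dvd_card_gal_of_not_isNondegenerate`; `Gal(Kᶜ/ℚ) ≅ ℤ₂ × A₄` or `ℤ₂ × S₄`), and the stabiliser of the block of `k`
is `2`-transitive on it (`IsCMTypeWith.exists_mem_stabilizer_smul_eq_of_block_four`, via Mathlib's
`alternatingGroup.isMultiplyPretransitive`).  This file only TRANSPORTS that statement from `Gal(Kᶜ/ℚ)` acting on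
`Hom_ℚ(K, Kᶜ)` (with `Kᶜ = normalClosure ℚ K ℂ`) to `Aut(ℂ)` acting on `Hom(K, ℂ)` (every automorphism of `Kᶜ ⊂ ℂ`
extends to `ℂ`: `Motives.ZarhinLie.exists_ringEquiv_complex_comp_eq`):

* **`twoTransitive_of_isSimple`** — `B ⊨ (K; Φ)` simple, `[K:ℚ] = 8`, `#{s ∈ Φ | s ∘ i = τ} = 2` ⟹ `Aut(ℂ)` is
  `2`-transitive on the four embeddings of `K` over `τ`;
* **`hodgeConjectureFor_biproduct_comp_vec_of_isSimple_of_markman₂`** — hence the intrinsic theorem of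
  `CorCM/OcticWeilFourfoldHodgeOfMarkman.lean` with the GEOMETRIC hypothesis «`B` simple» in place of `2`-transitivity:
  for every simple CM abelian fourfold `B` of `k`-signature `(2,2)` (the DEGENERATE simple CM fourfolds — Mumford–Pohlmann's
  examples) and the CM curve `E ⊨ (k; Ψ ∋ τ)`, `HodgeConjectureFor (⨁_j ![B, E] (κ j))` for EVERY `κ`, GIVEN ONLY Markman's
  fourfold theorem; `…_of_avDominatedBy_…`.
[cite: Dodson1984, §3.1.1 and §3.3.2 Theorem] [cite: Shimura1998, §8.2 Prop. 26] [cite: Markman2025SurveySecant, Thm. 1.2]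
[cite: MoonenZarhin1995Duke, Thm. 2.4] [cite: Gordon1999HodgeAVSurvey, 5.13 (ii)] [cite: Pohlmann1968, Thm 1 and §3]

## References
* [Dodson1984] B. Dodson, *The structure of Galois groups of CM-fields*, Trans. AMS 283 (1984), §3.1.1, §3.3.2 Theorem.
* [Shimura1998] G. Shimura, *Abelian varieties with complex multiplication and modular functions*, §8.2 Prop. 26.
* [Markman2025SurveySecant] E. Markman, arXiv:2509.23403, Thm. 1.2, §1.1.  [MoonenZarhin1995Duke] B. Moonen, Yu. Zarhin,
  Duke Math. J. 77 (1995), Thm. 2.4.  [Gordon1999HodgeAVSurvey] B. B. Gordon, CRM Monogr. 10 (1999), 5.1, 5.13 (ii).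
  [Pohlmann1968] H. Pohlmann, Ann. of Math. 88 (1968), Thm 1, §3 (Mumford's example).
-/

noncomputable section

open CategoryTheory CategoryTheory.Limits NumberField

namespace Summit.HodgeConjecture.CorCM.OcticWeilFourfold

open Literature.AlgebraicGeometry Literature.AlgebraicGeometry.Motives Literature.AlgebraicGeometry.HodgeTheory
open Literature.AlgebraicGeometry.ComplexMultiplication (IsCMTypeRealisation isSimple_iff_isPrimitive)
open Literature.AlgebraicGeometry.Pohlmann1968 (IsNondegenerate)
open Literature.AlgebraicTopology.SingularHomology
open Literature.NumberTheory.ComplexMultiplication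

open scoped Classical Pointwise

/-! ## §1 `2`-transitivity on the block, from simplicity (Dodson, transported to `Aut(ℂ)`) -/

section Galois

open IntermediateField

variable {K : Type} [Field K] [NumberField K] [IsCMField K] {k : Type} [Field k] [NumberField k] [IsCMField k]

/-- A number field is countable. [folklore] -/
theorem countable_of_numberField' (L : Type) [Field L] [NumberField L] : Countable L :=
  Countable.of_equiv _ (Module.finBasis ℚ L).equivFun.toEquiv.symm

/-- **A SIMPLE CM fourfold of Weil type has a `2`-TRANSITIVE quartic part.**  `K` a CM field of degree `8`, `i : k → K`
with `k` imaginary quadratic, `Φ` a CM type with exactly two members over `τ : k → ℂ`, realised by a SIMPLE abelian variety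
`B`.  Then for any two pairs `s ≠ t`, `s' ≠ t'` of embeddings of `K` over `τ` there is `ρ ∈ Aut(ℂ)` with `ρ ∘ s = s'` and
`ρ ∘ t = t'`.  Dodson §3.3.2 (tree, BY NAME): `Φ` is degenerate (weight `2` over the block of `k`) and primitive (`B`
simple, Shimura Prop. 26), so `3 ∣ |Gal(Kᶜ/ℚ)|` and `Gal(Kᶜ/k)` is `2`-transitive on the block; every element of
`Gal(Kᶜ/ℚ)`, `Kᶜ ⊂ ℂ`, extends to an automorphism of `ℂ`. [cite: Dodson1984, §3.3.2 Theorem] [cite: Shimura1998, §8.2 Prop. 26] -/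
theorem twoTransitive_of_isSimple (h8 : Module.finrank ℚ K = 8) (h2 : Module.finrank ℚ k = 2) (i : k →+* K)
    {Φ : CMType K} {B : AbelianVariety ℂ} {ιB : 𝓞 K →+* End B} {θB : K →+* Module.End ℂ (complexBetti B.X 1)}
    (hB : IsCMTypeRealisation Φ B ιB θB) (hS : B.IsSimple) (τ : k →+* ℂ)
    (h22 : (Finset.univ.filter fun s : K →+* ℂ => s.comp i = τ ∧ s ∈ Φ.1).card = 2) :
    ∀ s t s' t' : K →+* ℂ, s.comp i = τ → t.comp i = τ → s'.comp i = τ → t'.comp i = τ → s ≠ t → s' ≠ t' →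
      ∃ ρ : ℂ ≃+* ℂ, (ρ : ℂ →+* ℂ).comp s = s' ∧ (ρ : ℂ →+* ℂ).comp t = t' := by
  intro s t s' t' hs ht hs' ht' hst hst'
  -- the Galois closure `L = Kᶜ ⊂ ℂ`, a Galois CM field
  let L : Type := ↥(normalClosure ℚ K ℂ)
  haveI : IsNormalClosure ℚ K L := Algebra.IsAlgebraic.isNormalClosure_normalClosure fun x => IsAlgClosed.splits _
  haveI : NumberField L := { to_charZero := inferInstance, to_finiteDimensional := inferInstance }
  haveI : IsCMField L := Literature.NumberTheory.NumberFields.isCMField_normalClosure K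
  haveI : IsGalois ℚ L := Literature.NumberTheory.NumberFields.isGalois_normalClosure_complex K
  haveI : Countable L := countable_of_numberField' L
  let ι : L →+* ℂ := algebraMap L ℂ
  let φ : K →ₐ[ℚ] ℂ := s.toRatAlgHom
  let j : K →ₐ[ℚ] L := φ.codRestrict (normalClosure ℚ K ℂ).toSubalgebra fun x => φ.fieldRange_le_normalClosure ⟨x, rfl⟩
  -- the block of `k`: the type induced from `(k; {τ})`, with quadratic reflex field
  let Φ₀ : CMType K := inducedCMType i (CMTypeCount.single h2 τ)
  have hΦ₀ : ∀ u : K →+* ℂ, u ∈ Φ₀.1 ↔ u.comp i = τ := fun u => by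
    change u.comp i ∈ (CMTypeCount.single h2 τ).1 ↔ _
    rw [CMTypeCount.single_val, Set.mem_singleton_iff]
  have h2q : Module.finrank ℚ (reflexField ℚ L (algValuedIn ι Φ₀.1)) = 2 :=
    finrank_reflexField_algValuedIn_inducedCMType_single h2 i j ι τ
  -- `Φ` has weight `2` over the block, hence is degenerate; it is primitive since `B` is simple
  have hinter : (Φ.1 ∩ Φ₀.1).ncard = 2 := by
    have hset : Φ.1 ∩ Φ₀.1 = ↑(Finset.univ.filter fun s : K →+* ℂ => s.comp i = τ ∧ s ∈ Φ.1) := by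
      ext u
      rw [Finset.coe_filter]
      simp only [Set.mem_inter_iff, Finset.mem_univ, true_and, Set.mem_setOf_eq, hΦ₀ u]
      tauto
    rw [hset, Set.ncard_coe_finset, h22]
  have hdeg : ¬ IsNondegenerate Φ := not_isNondegenerate_of_ncard_inter_eq_two h8 j ι Φ₀ Φ h2q hinter
  have hprim : IsPrimitive (ℂ ≃+* ℂ) Φ.1 s := (isSimple_iff_isPrimitive hB s).1 hS
  have h3 : 3 ∣ Nat.card (L ≃ₐ[ℚ] L) := three_dvd_card_gal_of_not_isNondegenerate h8 j ι Φ s hprim hdeg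
  -- the block in `Hom_ℚ(K, L)` and its `2`-transitive stabiliser
  have h₀ := isCMTypeWith_conjGal_algValuedIn ι Φ₀
  have hG := smul_algValuedIn_eq_or_of_finrank_reflexField_eq_two j ι Φ₀ h2q
  have h4 : (algValuedIn ι Φ₀.1).ncard = 4 := by
    rw [ncard_algValuedIn j ι, ncard_cmType_eq, h8]
  -- the four embeddings read in `Hom_ℚ(K, L)`
  obtain ⟨a, ha⟩ := exists_algHom_comp_eq_of_normal j ι s
  obtain ⟨b, hb⟩ := exists_algHom_comp_eq_of_normal j ι t
  obtain ⟨c, hc⟩ := exists_algHom_comp_eq_of_normal j ι s'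
  obtain ⟨d, hd⟩ := exists_algHom_comp_eq_of_normal j ι t'
  have hmem : ∀ {x : K →ₐ[ℚ] L} {u : K →+* ℂ}, ι.comp (x : K →+* L) = u → u.comp i = τ → x ∈ algValuedIn ι Φ₀.1 :=
    fun {x u} hx hu => by rw [mem_algValuedIn_iff, hx, hΦ₀]; exact hu
  have hab : a ≠ b := fun h => hst (by rw [← ha, ← hb, h])
  have hcd : c ≠ d := fun h => hst' (by rw [← hc, ← hd, h])
  obtain ⟨m, -, hma, hmb⟩ := h₀.exists_mem_stabilizer_smul_eq_of_block_four hG h4 h3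
    (hmem ha hs) (hmem hb ht) (hmem hc hs') (hmem hd ht') hab hcd
  -- extend `m ∈ Gal(L/ℚ)` to `ρ ∈ Aut(ℂ)`
  obtain ⟨ρ, hρ⟩ := Motives.ZarhinLie.exists_ringEquiv_complex_comp_eq ι (ι.comp (m : L →+* L))
  have key : ∀ {x y : K →ₐ[ℚ] L} {u v : K →+* ℂ}, ι.comp (x : K →+* L) = u → ι.comp (y : K →+* L) = v →
      m • x = y → (ρ : ℂ →+* ℂ).comp u = v := by
    intro x y u v hx hy hxy
    rw [← hx, ← hy, ← hxy]
    refine RingHom.ext fun z => ?_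
    change ρ (ι (x z)) = ι ((m • x) z)
    rw [hρ, algEquiv_smul_apply]
    rfl
  exact ⟨ρ, key ha hc hma, key hb hd hmb⟩

end Galois

/-! ## §2 The geometric form: `B` simple -/

section Main

variable {K : Type} [Field K] [NumberField K] [IsCMField K] {k : Type} [Field k] [NumberField k] [IsCMField k]
  {N : ℕ} {Φ : CMType K} {B : AbelianVariety ℂ} {ιB : 𝓞 K →+* End B} {θB : K →+* Module.End ℂ (complexBetti B.X 1)}
  {Ψ : CMType k} {E : AbelianVariety ℂ} {ιE : 𝓞 k →+* End E} {θE : k →+* Module.End ℂ (complexBetti E.X 1)}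

/-- **THE HODGE CONJECTURE FOR EVERY PRODUCT OF COPIES OF A SIMPLE CM FOURFOLD OF WEIL TYPE AND ITS CM CURVE, GIVEN ONLY
Markman's fourfold theorem.**  `K` ANY CM field of degree `8`, `k` imaginary quadratic with `i : k → K`; `B ⊨ (K; Φ)`
SIMPLE with `#{s ∈ Φ | s ∘ i = τ} = 2` (`k`-signature `(2,2)`: a DEGENERATE simple CM fourfold, of Weil type for `k`;
Dodson: `Gal(Kᶜ/ℚ) ≅ ℤ₂ × A₄` or `ℤ₂ × S₄`), `E ⊨ (k; Ψ)` with `τ ∈ Ψ`.  Then for every `κ : Fin N → Fin 2`, every rational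
`(q,q)`-class on `⨁_j ![B, E] (κ j)` — `B^n × E^a`, any `n, a`, any order — is algebraic.  (`B^n` alone: lit-pohlmann's
`Pohlmann1968.SimpleCMFourfoldPowersHodgeConjecture`; the `k`-signature `(1,3)` companion, for ANY CM fourfold `B`,
modulo Markman's SIXFOLD theorem: gen 18's `OcticCurveFourfold.hodgeConjectureFor_biproduct_comp_vec_of_markmanSixfold`.)
[cite: Markman2025SurveySecant, Thm. 1.2] [cite: Dodson1984, §3.3.2 Theorem] [cite: Shimura1998, §8.2 Prop. 26]
[cite: Pohlmann1968, Thm 1 and §3] -/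
theorem hodgeConjectureFor_biproduct_comp_vec_of_isSimple_of_markman₂
    (hW4 : Markman2025_weilClasses_algebraic_abelianFourfold)
    (h8 : Module.finrank ℚ K = 8) (h2 : Module.finrank ℚ k = 2) (i : k →+* K)
    (hB : IsCMTypeRealisation Φ B ιB θB) (hS : B.IsSimple) (hE : IsCMTypeRealisation Ψ E ιE θE)
    {τ : k →+* ℂ} (hτΨ : τ ∈ Ψ.1)
    (h22 : (Finset.univ.filter fun s : K →+* ℂ => s.comp i = τ ∧ s ∈ Φ.1).card = 2) (κ : Fin N → Fin 2) :
    HodgeConjectureFor (⨁ fun j => (![B, E] : Fin 2 → AbelianVariety ℂ) (κ j)).dim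
      (⨁ fun j => (![B, E] : Fin 2 → AbelianVariety ℂ) (κ j)).X :=
  hodgeConjectureFor_biproduct_comp_vec_of_markman₂ hW4 h8 h2 i hB hE hτΨ h22
    (twoTransitive_of_isSimple h8 h2 i hB hS τ h22) κ

/-- **… and for every abelian variety dominated by such a product** (isogeny factors, quotients, abelian subvarieties of
some `B^n × E^a`). [cite: Markman2025SurveySecant, Thm. 1.2] [cite: MumfordAV1970, §19] -/
theorem hodgeConjectureFor_of_avDominatedBy_comp_vec_of_isSimple_of_markman₂
    (hW4 : Markman2025_weilClasses_algebraic_abelianFourfold)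
    (h8 : Module.finrank ℚ K = 8) (h2 : Module.finrank ℚ k = 2) (i : k →+* K)
    (hB : IsCMTypeRealisation Φ B ιB θB) (hS : B.IsSimple) (hE : IsCMTypeRealisation Ψ E ιE θE)
    {τ : k →+* ℂ} (hτΨ : τ ∈ Ψ.1)
    (h22 : (Finset.univ.filter fun s : K →+* ℂ => s.comp i = τ ∧ s ∈ Φ.1).card = 2) (κ : Fin N → Fin 2)
    {C : AbelianVariety ℂ} (hC : Domination.AVDominatedBy C (⨁ fun j => (![B, E] : Fin 2 → AbelianVariety ℂ) (κ j))) :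
    HodgeConjectureFor C.dim C.X :=
  Domination.hodgeConjectureFor_of_avDominatedBy
    (hodgeConjectureFor_biproduct_comp_vec_of_isSimple_of_markman₂ hW4 h8 h2 i hB hS hE hτΨ h22 κ) hC

end Main

end Summit.HodgeConjecture.CorCM.OcticWeilFourfold

end
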